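import Mathlib
import HarnessLib
import Summits.Parity.BatemanHorn.Theorems.AlmostPrimeZerosSystemZeroRepulsionLongCyclesRecurrence
import Summits.Parity.BatemanHorn.Theorems.AlmostPrimeZerosSystemZeroRepulsionLongCyclesCharlier

/-!
# Lattice domination of the zeros of the long-cycle recurrence (crux stmt-Parity-11291, line
`buchstab-flow-hyperbolicity`, stub `LongCyclesLattice`, part 3)

Everything here is PROVED (theorems only).  For `R 0 = R 1 = 1`,
`R (n+2) = (n+2) R (n+1) + (n+1)(X − 1) R n`: for every `n` and every `m : ℕ`, at most `m` zeros
`ρ` of `R n` (all real, simple, negative by part 1) satisfy `|1 − ρ| < m + 1`, i.e. lie in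
`(−m, 0)` (`rec_latticeDominated`): the `j`-th largest zero is `≤ −(j−1)`.  Proof: let
`c_n = #{ρ : R n (ρ) = 0, ρ > −m}`.  By the interlacing tower (part 1) `c_{n+1} ≤ c_n + 1`, with
equality forcing a sign change of `k ↦ R k (−m)` between consecutive non-zero terms (zeros of the
sequence are isolated and transparent); by part 2 the sign of `R k (−m)` is the sign of the fixed
polynomial `Q_m` (degree `≤ m`) at `k`, so `c_n ≤ #{zeros of Q_m in (0, n)} ≤ m`.
-/

open Polynomial Finset

namespace Summit.Parity.BatemanHorn.Cruxes.SystemZeroRepulsion.BuchstabFlowHyperbolicity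

/-- The Charlier-type polynomial `Q_m` as an element of `ℝ[X]`: evaluation, non-vanishing at `0`,
degree `≤ m`. -/
theorem charlierPoly_facts (m : ℕ) :
    (∀ y : ℝ, (∑ j ∈ Finset.range (m + 1), C ((-1 : ℝ) ^ j * (m.choose j : ℝ) * ((m : ℝ) + 1) ^ (m - j)) *
        descPochhammer ℝ j).eval y =
      ∑ j ∈ Finset.range (m + 1), ((-1 : ℝ) ^ j * (m.choose j : ℝ) * ((m : ℝ) + 1) ^ (m - j)) *
        (descPochhammer ℝ j).eval y) ∧
    (∑ j ∈ Finset.range (m + 1), C ((-1 : ℝ) ^ j * (m.choose j : ℝ) * ((m : ℝ) + 1) ^ (m - j)) *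
        descPochhammer ℝ j) ≠ 0 ∧
    (∑ j ∈ Finset.range (m + 1), C ((-1 : ℝ) ^ j * (m.choose j : ℝ) * ((m : ℝ) + 1) ^ (m - j)) *
        descPochhammer ℝ j).natDegree ≤ m := by
  have hev : ∀ y : ℝ, (∑ j ∈ Finset.range (m + 1), C ((-1 : ℝ) ^ j * (m.choose j : ℝ) * ((m : ℝ) + 1) ^ (m - j)) *
        descPochhammer ℝ j).eval y =
      ∑ j ∈ Finset.range (m + 1), ((-1 : ℝ) ^ j * (m.choose j : ℝ) * ((m : ℝ) + 1) ^ (m - j)) *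
        (descPochhammer ℝ j).eval y := by
    intro y
    rw [eval_finsetSum]
    simp only [eval_mul, eval_C]
  refine ⟨hev, ?_, ?_⟩
  · intro h0
    have h1 := hev 0
    rw [h0, eval_zero, charlier_eval_zero] at h1
    exact absurd h1.symm (pow_ne_zero _ (by positivity))
  · refine natDegree_sum_le_of_forall_le _ _ fun j hj => ?_
    have hjm : j ≤ m := Nat.lt_succ_iff.mp (Finset.mem_range.mp hj)
    exact (natDegree_C_mul_le _ _).trans ((descPochhammer_natDegree (R := ℝ) j).le.trans hjm)

/-! ### The lattice count -/

section Recurrence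

variable {R : ℕ → ℝ[X]} (h0 : R 0 = 1) (h1 : R 1 = 1)
  (hrec : ∀ n : ℕ, R (n + 2) = C ((n : ℝ) + 2) * R (n + 1) + C ((n : ℝ) + 1) * (X - 1) * R n)
include h0 h1 hrec

/-- **Sign-change bound.** For every `m` and `n`: the number of zeros of `R n` in `(−m, ∞)` is at
most the number of zeros of `Q_m` in the real interval `(0, n)`. -/
theorem rec_count_le_charlier_roots (m : ℕ) : ∀ n : ℕ,
    ((R n).roots.filter fun ρ : ℝ => -(m : ℝ) < ρ).card ≤
      ((∑ j ∈ Finset.range (m + 1), C ((-1 : ℝ) ^ j * (m.choose j : ℝ) * ((m : ℝ) + 1) ^ (m - j)) *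
        descPochhammer ℝ j).roots.filter fun y : ℝ => 0 < y ∧ y < (n : ℝ)).card := by
  set Qp : ℝ[X] := ∑ j ∈ Finset.range (m + 1), C ((-1 : ℝ) ^ j * (m.choose j : ℝ) * ((m : ℝ) + 1) ^ (m - j)) *
      descPochhammer ℝ j with hQp
  obtain ⟨hQev, hQne, -⟩ := charlierPoly_facts m
  rw [← hQp] at hQev hQne
  set x : ℝ := -(m : ℝ) with hx
  -- closed form: a_k (m+1)^m = (m+1)^k Q(k)
  have hclosed : ∀ k : ℕ, (R k).eval x * ((m : ℝ) + 1) ^ m = ((m : ℝ) + 1) ^ k * Qp.eval (k : ℝ) := by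
    intro k; rw [hQev]; exact rec_eval_neg_nat h0 h1 hrec m k
  have hm1 : (0 : ℝ) < (m : ℝ) + 1 := by positivity
  -- monotonicity of the root count of Q in k
  have hZmono : ∀ k k' : ℕ, k ≤ k' → (Qp.roots.filter fun y : ℝ => 0 < y ∧ y < (k : ℝ)).card ≤
      (Qp.roots.filter fun y : ℝ => 0 < y ∧ y < (k' : ℝ)).card := by
    intro k k' hkk'
    exact Multiset.card_le_card (Multiset.monotone_filter_right _ fun y hy =>
      ⟨hy.1, hy.2.trans_le (by exact_mod_cast hkk')⟩)
  -- two-step induction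
  have key : ∀ n : ℕ, ((R n).roots.filter fun ρ : ℝ => x < ρ).card ≤
      (Qp.roots.filter fun y : ℝ => 0 < y ∧ y < (n : ℝ)).card ∧
      ((R (n + 1)).roots.filter fun ρ : ℝ => x < ρ).card ≤
      (Qp.roots.filter fun y : ℝ => 0 < y ∧ y < ((n + 1 : ℕ) : ℝ)).card := by
    intro n
    induction n with
    | zero => exact ⟨by rw [h0, roots_one]; simp, by rw [h1, roots_one]; simp⟩
    | succ n ih =>
      refine ⟨ih.2, ?_⟩
      obtain ⟨ihn, ihn1⟩ := ih
      -- the tower at levels n+1 and n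
      obtain ⟨e, d, t, r, he, hd, ht, hr, htneg, hrneg, hprodh, hprodf, hbl⟩ := rec_tower h0 h1 hrec (n + 1)
      obtain ⟨d₂, dg, r₂, s, hd₂, hdg, hr₂, hs, -, hsneg, hprodf₂, hprodg, hbl₂⟩ := rec_tower h0 h1 hrec n
      have hdeg := rec_natDegree_leadingCoeff h0 h1 hrec
      obtain rfl : d = d₂ := by rw [← hd₂, ← hd]
      have hκh : 0 < (R (n + 1 + 1)).leadingCoeff := (hdeg _).2
      have hκf : 0 < (R (n + 1)).leadingCoeff := (hdeg _).2
      have hκg : 0 < (R n).leadingCoeff := (hdeg _).2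
      obtain ⟨hhC, hhroots⟩ := roots_eq_of_normalised t hκh hprodh
      obtain ⟨hfC, hfroots⟩ := roots_eq_of_normalised r hκf hprodf
      obtain ⟨-, hfroots₂⟩ := roots_eq_of_normalised r₂ hκf hprodf₂
      obtain ⟨-, hgroots⟩ := roots_eq_of_normalised s hκg hprodg
      obtain rfl : r = r₂ := enum_unique hr hr₂ (hfroots.symm.trans hfroots₂)
      have hed : e = d ∨ e = d + 1 := by
        have h1' := (hdeg (n + 1)).1; have h2' := (hdeg (n + 1 + 1)).1
        rw [hd] at h1'; rw [he] at h2'; omega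
      have hed₂ : d = dg ∨ d = dg + 1 := by
        have h1' := (hdeg (n + 1)).1; have h2' := (hdeg n).1
        rw [hd] at h1'; rw [hdg] at h2'; omega
      -- the three counts
      rw [show n + 1 + 1 = n + 1 + 1 from rfl, hhroots, card_filter_map_univ]
      rw [hfroots, card_filter_map_univ] at ihn1
      rw [hgroots, card_filter_map_univ] at ihn
      set ch := (Finset.univ.filter fun j : Fin e => x < t j).card with hch
      set cf := (Finset.univ.filter fun i : Fin d => x < r i).card with hcf
      set cg := (Finset.univ.filter fun l : Fin dg => x < s l).card with hcg
      have F1 : ch ≤ cf + 1 := card_filter_lt_le_succ_of_blocks t r hed hbl x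
      have hZ12 := hZmono (n + 1) (n + 1 + 1) (by omega)
      have hZ02 := hZmono n (n + 1 + 1) (by omega)
      by_cases hA : ch ≤ cf
      · exact hA.trans (ihn1.trans hZ12)
      have hB : ch = cf + 1 := by omega
      by_cases hh : (R (n + 1 + 1)).eval x = 0
      · -- x is a root of h: then ch = cf, contradiction
        exfalso
        have hmem : x ∈ (R (n + 1 + 1)).roots := (mem_roots (rec_ne_zero h0 h1 hrec _)).mpr hh
        rw [hhroots] at hmem
        obtain ⟨j₀, -, hj₀⟩ := Multiset.mem_map.mp hmem
        have := card_filter_lt_eq_of_blocks t r ht hed hbl j₀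
        rw [hj₀] at this
        omega
      by_cases hf : (R (n + 1)).eval x = 0
      · -- x is a root of f: then cf = cg and Q(n+1) = 0 is a new root of Q in (n, n+2)
        have hmem : x ∈ (R (n + 1)).roots := (mem_roots (rec_ne_zero h0 h1 hrec _)).mpr hf
        rw [hfroots] at hmem
        obtain ⟨i₀, -, hi₀⟩ := Multiset.mem_map.mp hmem
        have hcfg : cf = cg := by
          have := card_filter_lt_eq_of_blocks r s hr hed₂ hbl₂ i₀
          rw [hi₀] at this
          exact this
        have hQroot : Qp.eval ((n : ℝ) + 1) = 0 := by
          have := hclosed (n + 1)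
          rw [hf, zero_mul] at this
          push_cast at this
          rcases mul_eq_zero.mp this.symm with h' | h'
          · exact absurd h' (pow_ne_zero _ hm1.ne')
          · exact h'
        have hyS : ((n : ℝ) + 1) ∈ Qp.roots := (mem_roots hQne).mpr hQroot
        have hstep := card_filter_succ_le (S := Qp.roots) (p := fun y : ℝ => 0 < y ∧ y < (n : ℝ))
          (q := fun y : ℝ => 0 < y ∧ y < ((n + 1 + 1 : ℕ) : ℝ))
          (fun y hy => ⟨hy.1, hy.2.trans (by push_cast; linarith)⟩) hyS
          ⟨by positivity, by push_cast; linarith⟩ (fun h' => by linarith [h'.2])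
        omega
      · -- both non-zero: opposite signs, so Q changes sign on (n+1, n+2)
        have hxr : ∀ i, x ≠ r i := by
          intro i hxi
          apply hf
          rw [hfC, eval_mul, eval_prod]
          exact mul_eq_zero_of_right _ (Finset.prod_eq_zero (Finset.mem_univ i) (by simp [hxi]))
        have hxt : ∀ j, x ≠ t j := by
          intro j hxj
          apply hh
          rw [hhC, eval_mul, eval_prod]
          exact mul_eq_zero_of_right _ (Finset.prod_eq_zero (Finset.mem_univ j) (by simp [hxj]))
        have hsf := sign_eval_of_prod r hr hκf x hxr
        have hsh := sign_eval_of_prod t ht hκh x hxt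
        rw [← hfC, ← hcf] at hsf
        rw [← hhC, ← hch, hB, pow_succ] at hsh
        have hprod_neg : (R (n + 1)).eval x * (R (n + 1 + 1)).eval x < 0 := by
          have hsq : ((-1 : ℝ)) ^ cf * (-1) ^ cf = 1 := by rw [← pow_add, ← two_mul, pow_mul]; norm_num
          nlinarith [mul_pos hsf hsh]
        have hQneg : Qp.eval ((n : ℝ) + 1) * Qp.eval ((n : ℝ) + 2) < 0 := by
          have e1 := hclosed (n + 1)
          have e2 := hclosed (n + 1 + 1)
          push_cast at e1 e2
          rw [show ((n : ℝ) + 1 + 1) = (n : ℝ) + 2 by ring] at e2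
          have hpos : (0 : ℝ) < ((m : ℝ) + 1) ^ (n + 1) * ((m : ℝ) + 1) ^ (n + 1 + 1) := by positivity
          have hpm : (0 : ℝ) < ((m : ℝ) + 1) ^ m * ((m : ℝ) + 1) ^ m := by positivity
          by_contra hge
          push Not at hge
          have : 0 ≤ ((R (n + 1)).eval x * ((m : ℝ) + 1) ^ m) * ((R (n + 1 + 1)).eval x * ((m : ℝ) + 1) ^ m) := by
            rw [e1, e2]
            have : ((m : ℝ) + 1) ^ (n + 1) * Qp.eval ((n : ℝ) + 1) * (((m : ℝ) + 1) ^ (n + 1 + 1) * Qp.eval ((n : ℝ) + 2))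
                = (((m : ℝ) + 1) ^ (n + 1) * ((m : ℝ) + 1) ^ (n + 1 + 1)) * (Qp.eval ((n : ℝ) + 1) * Qp.eval ((n : ℝ) + 2)) := by
              ring
            rw [this]
            exact mul_nonneg hpos.le hge
          nlinarith [this, hprod_neg, hpm]
        obtain ⟨y, hy1, hy2, hy0⟩ := exists_root_of_mul_neg Qp (by linarith : (n : ℝ) + 1 < (n : ℝ) + 2) hQneg
        have hyS : y ∈ Qp.roots := (mem_roots hQne).mpr hy0
        have hstep := card_filter_succ_le (S := Qp.roots) (p := fun y : ℝ => 0 < y ∧ y < ((n + 1 : ℕ) : ℝ))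
          (q := fun y : ℝ => 0 < y ∧ y < ((n + 1 + 1 : ℕ) : ℝ))
          (fun z hz => ⟨hz.1, hz.2.trans (by push_cast; linarith)⟩) hyS
          ⟨by have : (0 : ℝ) ≤ n := Nat.cast_nonneg n; linarith, by push_cast; linarith⟩
          (fun h' => by have := h'.2; push_cast at this; linarith)
        omega
  exact fun n => (key n).1

end Recurrence

/-- **Lattice domination for the three-term recurrence (closed form, registered).**  For any
`R : ℕ → ℝ[X]` with `R 0 = R 1 = 1`, `R (n+2) = (n+2)·R (n+1) + (n+1)·(X − 1)·R n` — in particular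
the long-cycle polynomials `Σ_{σ ∈ S_n} z^{#cycles of length ≥ 2}` — and every `m : ℕ`, at most `m`
roots `ρ` of `R n` (with multiplicity) satisfy `|1 − ρ| < m + 1`; since all roots are real and
negative this says the `j`-th largest zero is `≤ −(j − 1)`. -/
theorem rec_latticeDominated : ∀ (R : ℕ → Polynomial ℝ), R 0 = 1 → R 1 = 1 →
    (∀ n : ℕ, R (n + 2) = Polynomial.C ((n : ℝ) + 2) * R (n + 1) +
      Polynomial.C ((n : ℝ) + 1) * (Polynomial.X - 1) * R n) →
    ∀ n m : ℕ, ((R n).roots.filter fun ρ : ℝ => |1 - ρ| < (m : ℝ) + 1).card ≤ m := by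
  intro R h0 h1 hrec n m
  obtain ⟨-, -, hneg⟩ := rec_realRooted R h0 h1 hrec n
  obtain ⟨-, hQne, hQdeg⟩ := charlierPoly_facts m
  have hfilt : ((R n).roots.filter fun ρ : ℝ => |1 - ρ| < (m : ℝ) + 1) =
      (R n).roots.filter fun ρ : ℝ => -(m : ℝ) < ρ := by
    refine Multiset.filter_congr fun ρ hρ => ?_
    have hρ0 := hneg ρ hρ
    rw [abs_of_pos (by linarith)]
    constructor <;> intro h <;> linarith
  rw [hfilt]
  refine (rec_count_le_charlier_roots h0 h1 hrec m n).trans ?_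
  exact ((Multiset.card_le_card (Multiset.filter_le _ _)).trans (card_roots' _)).trans hQdeg

end Summit.Parity.BatemanHorn.Cruxes.SystemZeroRepulsion.BuchstabFlowHyperbolicity
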